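import Literature.NumberTheory.LFunctions.LiouvilleOneSidedRH
import Literature.NumberTheory.LFunctions.SiegelWalfiszLiouville
import Literature.NumberTheory.LFunctions.MertensBoundRH
import Mathlib.Analysis.SpecialFunctions.Pow.Asymptotics
import Mathlib.Analysis.PSeries
import HarnessLib

/-!
# RH-EQUIVALENT — `RH ⟺ L(x) = ∑_{n ≤ x} λ(n) = O(x^{1/2+ε})` for every `ε > 0` (PROVED)

RH-EQUIVALENT (a statement `RiemannHypothesis ↔ …`); nothing here bears on the truth of RH.
Literature-typing tranche 1 (Broughan, *Equivalents of the Riemann Hypothesis* vol. 1, the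
Liouville-function material of the arithmetic chapters; printed with proof in Mossinghoff–Trudgian
2012, Thm. 2.2 (case `α = 0`): "If the Riemann hypothesis holds, then … `L_α(x) = O(x^{1/2−α+ε})`.
Conversely, if this estimate holds for some `α ∈ [0, 1/2]`, then the Riemann hypothesis is true",
introduced there by "It is well known that the Riemann hypothesis is equivalent to the statement
that `L₀(x) = O(x^{1/2+ε})`").  The tree held the two ONE-SIDED Liouville criteria
(`riemannHypothesis_of_liouvilleSum_oneSided`, Pólya/Ingham) and the Möbius two-sided criterion
(`riemannHypothesis_iff_mertensFunction_isBigO`, Littlewood); this file PROVES the two-sided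
Liouville criterion `riemannHypothesis_iff_liouvilleSum_isBigO` (with the explicit-range bound
`exists_abs_liouvilleSum_le_of_riemannHypothesis` under RH).

Proof (ours; Mossinghoff–Trudgian argue with Perron's formula for `ζ(2s)/ζ(s)` — we take the
shorter road through results already in the tree):
* `⟹`: `λ = 𝟙_□ ⋆ μ`, i.e. `L(N) = ∑_{a ≤ N, a = □} M(⌊N/a⌋)` (tree:
  `LiouvilleSum.sum_liouville_eq`), and under RH `|M(y)| ≤ C y^{1/2+ε}` for `y ≥ 1` (Littlewood /
  Titchmarsh 14.25 (C), tree: `riemannHypothesis_iff_mertensFunction_isBigO_holds`), so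
  `|L(N)| ≤ C N^{1/2+ε} ∑_{r ≤ √N} r^{−1−2ε} ≤ C ζ(1+2ε) N^{1/2+ε}`.
* `⟸`: `L(x) = O(x^{1/2+ε})` for every `ε` makes `∫₁^∞ L(x) x^{−s−1} dx` absolutely convergent on
  `Re s > 1/2`, so `ζ(2s)/(s ζ(s))` (tree: `mellin_liouville_mul_eq`,
  `riemannZeta_ne_zero_of_liouville_integrable`, Landau/BFM §1) has no poles there: no zeros of `ζ`
  on `Re s > 1/2`, none on `0 < Re s < 1/2` by the functional equation, which is RH in strip form
  (`riemannHypothesis_iff_strip_holds`) — the same closing as the tree's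
  `riemannHypothesis_of_liouvilleSum_oneSided`.

## References

* M. J. Mossinghoff, T. S. Trudgian, *Between the problems of Pólya and Turán*, J. Aust. Math.
  Soc. 93 (2012) 157–171, §2 and Thm. 2.2 (read: `lit read paper:doi-10-1017-s1446788712000201`,
  pp. 3–4). [MossinghoffTrudgian2012]
* E. C. Titchmarsh, *The Theory of the Riemann Zeta-Function*, 2nd ed., Thm. 14.25 (C).
  [Titchmarsh1986]
* K. Broughan, *Equivalents of the Riemann Hypothesis. Vol. 1: Arithmetic Equivalents*, CUP 2017
  (not held; the Liouville function is treated with the Möbius function in the arithmetic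
  chapters). [Broughan2017Arithmetic]
-/

noncomputable section

open Real Filter Finset ArithmeticFunction Asymptotics MeasureTheory
open scoped ArithmeticFunction.Moebius

namespace Literature.NumberTheory.LFunctions

namespace LiouvilleBigO

/-! ### Trivial bounds and the floor reduction -/

/-- `L(x) = L(⌊x⌋)`. [cite: MossinghoffTrudgian2012, §2] -/
theorem liouvilleSum_natFloor (x : ℝ) : liouvilleSum ((⌊x⌋₊ : ℕ) : ℝ) = liouvilleSum x := by
  unfold liouvilleSum
  rw [Nat.floor_natCast]

/-! ### `⟸`: absolute convergence of the Mellin integral on `Re s > 1/2` -/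

/-- If `L(x) = O(x^{1/2+ε})` for every `ε > 0`, then `L(x) x^{−σ−1}` is integrable on `(1, ∞)` for
every `σ > 1/2`. [cite: MossinghoffTrudgian2012, Thm. 2.2 (converse, partial summation)] -/
theorem integrableOn_liouvilleSum_rpow
    (hL : ∀ ε : ℝ, 0 < ε →
      (fun x : ℝ => (liouvilleSum x : ℝ)) =O[atTop] fun x : ℝ => x ^ (1 / 2 + ε))
    {σ : ℝ} (hσ : 1 / 2 < σ) :
    IntegrableOn (fun x ↦ (liouvilleSum x : ℝ) * x ^ (-(σ + 1))) (Set.Ioi 1) := by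
  set ε : ℝ := (σ - 1 / 2) / 2 with hε
  have hε0 : 0 < ε := by rw [hε]; linarith
  obtain ⟨C, hC0, hC⟩ := (hL ε hε0).exists_pos
  obtain ⟨x₁, hx₁⟩ := eventually_atTop.1 hC.bound
  set x₀ : ℝ := max x₁ 1 with hx₀
  have hx₀1 : 1 ≤ x₀ := le_max_right _ _
  have hK0 : 0 ≤ x₀ ^ (1 + ε) := rpow_nonneg (by linarith) _
  -- domination by `(C + x₀^{1+ε}) x^{-(1+ε)}` on `(1, ∞)`
  have hdom : ∀ x : ℝ, 1 < x →
      |(liouvilleSum x : ℝ) * x ^ (-(σ + 1))| ≤ (C + x₀ ^ (1 + ε)) * x ^ (-(1 + ε)) := by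
    intro x hx
    have hx0 : 0 < x := by linarith
    have hxp : 0 < x ^ (-(1 + ε)) := rpow_pos_of_pos hx0 _
    rw [abs_mul, abs_of_pos (rpow_pos_of_pos hx0 _)]
    by_cases hxx : x₀ ≤ x
    · -- large `x`: the `O`-bound
      have hb := hx₁ x ((le_max_left _ _).trans hxx)
      rw [Real.norm_eq_abs, Real.norm_of_nonneg (rpow_nonneg hx0.le _)] at hb
      calc |(liouvilleSum x : ℝ)| * x ^ (-(σ + 1))
          ≤ C * x ^ (1 / 2 + ε) * x ^ (-(σ + 1)) :=
            mul_le_mul_of_nonneg_right hb (rpow_nonneg hx0.le _)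
        _ = C * x ^ (-(1 + ε)) := by
            rw [mul_assoc, ← rpow_add hx0]; congr 2; rw [hε]; ring
        _ ≤ (C + x₀ ^ (1 + ε)) * x ^ (-(1 + ε)) := by nlinarith
    · -- small `x`: the trivial bound `|L(x)| ≤ x`, `x^{-σ} ≤ 1 ≤ (x₀/x)^{1+ε}`
      push Not at hxx
      have hLx : |(liouvilleSum x : ℝ)| ≤ x := by
        unfold liouvilleSum
        push_cast
        exact (LiouvilleSum.abs_sum_liouville_le ⌊x⌋₊).trans (Nat.floor_le hx0.le)
      have h1 : |(liouvilleSum x : ℝ)| * x ^ (-(σ + 1)) ≤ 1 := by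
        calc |(liouvilleSum x : ℝ)| * x ^ (-(σ + 1)) ≤ x * x ^ (-(σ + 1)) :=
              mul_le_mul_of_nonneg_right hLx (rpow_nonneg hx0.le _)
          _ = x ^ (-σ) := by
              rw [show -σ = 1 + -(σ + 1) by ring, rpow_add hx0, rpow_one]
          _ ≤ 1 := rpow_le_one_of_one_le_of_nonpos hx.le (by linarith)
      have h2 : (1 : ℝ) ≤ x₀ ^ (1 + ε) * x ^ (-(1 + ε)) := by
        rw [rpow_neg hx0.le, ← div_eq_mul_inv, ← div_rpow (by linarith) hx0.le]
        exact one_le_rpow ((one_le_div hx0).2 hxx.le) (by linarith)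
      nlinarith
  have hmeas : AEStronglyMeasurable (fun x : ℝ ↦ (liouvilleSum x : ℝ) * x ^ (-(σ + 1)))
      (volume.restrict (Set.Ioi 1)) :=
    (measurable_liouvilleSum.mul (measurable_id.pow_const _)).aestronglyMeasurable
  refine Integrable.mono' (((integrableOn_Ioi_rpow_of_lt (by linarith : -(1 + ε) < -1)
    one_pos).const_mul (C + x₀ ^ (1 + ε)))) hmeas ?_
  refine (ae_restrict_iff' measurableSet_Ioi).2 (ae_of_all _ fun x hx => ?_)
  rw [Real.norm_eq_abs]
  exact hdom x hx

end LiouvilleBigO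

open LiouvilleBigO in
/-- **`L(x) = O(x^{1/2+ε})` for every `ε > 0` implies RH** (Mossinghoff–Trudgian 2012, Thm. 2.2,
converse, case `α = 0`), PROVED: Landau's theorem on the Mellin transform of `L`
(`riemannZeta_ne_zero_of_liouville_integrable`) excludes zeros on `Re s > 1/2`, the functional
equation those on `Re s < 1/2`. [cite: MossinghoffTrudgian2012, Thm. 2.2 (converse)] -/
private theorem riemannHypothesis_of_liouvilleSum_isBigO
    (hL : ∀ ε : ℝ, 0 < ε →
      (fun x : ℝ => (liouvilleSum x : ℝ)) =O[atTop] fun x : ℝ => x ^ (1 / 2 + ε)) :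
    RiemannHypothesis := by
  have hI : ∀ σ : ℝ, 1 / 2 < σ →
      IntegrableOn (fun x ↦ (liouvilleSum x : ℝ) * x ^ (-(σ + 1))) (Set.Ioi 1) :=
    fun σ hσ ↦ integrableOn_liouvilleSum_rpow hL hσ
  have hright : ∀ s : ℂ, 1 / 2 < s.re → riemannZeta s ≠ 0 :=
    fun s hs ↦ riemannZeta_ne_zero_of_liouville_integrable hI hs
  have e : RiemannHypothesis ↔ RiemannHypothesisStrip := riemannHypothesis_iff_strip_holds
  refine e.2 fun ρ hζ h0 h1 ↦ ?_
  rcases lt_trichotomy ρ.re (1 / 2) with h | h | h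
  · exfalso
    have hρn : ∀ n : ℕ, ρ ≠ -n := by
      intro n hn
      have := congrArg Complex.re hn
      simp at this
      linarith
    have hρ1 : ρ ≠ 1 := by
      intro h1'
      rw [h1'] at h1
      simp at h1
    have h1ρ : riemannZeta (1 - ρ) = 0 := by
      rw [riemannZeta_one_sub hρn hρ1, hζ, mul_zero]
    exact hright (1 - ρ) (by simp; linarith) h1ρ
  · exact h
  · exact absurd hζ (hright ρ h)

namespace LiouvilleBigO

/-! ### `⟹`: `L(N) = ∑_{a = □ ≤ N} M(⌊N/a⌋)` and the RH bound for `M` -/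

/-- From `M(x) = O(x^{1/2+ε})` to a bound `|M(y)| ≤ C y^{1/2+ε}` valid for ALL `y ≥ 1` (absorbing
the finitely many small `y` with the trivial `|M(y)| ≤ y`). [cite: Titchmarsh1986, Thm. 14.25 (C)] -/
theorem exists_abs_mertensFunction_le {ε : ℝ} (hε : 0 < ε)
    (hM : (fun x : ℝ => (mertensFunction x : ℝ)) =O[atTop] fun x : ℝ => x ^ (1 / 2 + ε)) :
    ∃ C : ℝ, 0 < C ∧ ∀ y : ℝ, 1 ≤ y → |(mertensFunction y : ℝ)| ≤ C * y ^ (1 / 2 + ε) := by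
  obtain ⟨C, hC0, hC⟩ := hM.exists_pos
  obtain ⟨x₁, hx₁⟩ := eventually_atTop.1 hC.bound
  refine ⟨C + max x₁ 1, by positivity, fun y hy => ?_⟩
  have hy0 : 0 < y := by linarith
  have hyp : 1 ≤ y ^ (1 / 2 + ε) := one_le_rpow hy (by linarith)
  by_cases hyy : x₁ ≤ y
  · have hb := hx₁ y hyy
    rw [Real.norm_eq_abs, Real.norm_of_nonneg (rpow_nonneg hy0.le _)] at hb
    calc |(mertensFunction y : ℝ)| ≤ C * y ^ (1 / 2 + ε) := hb
      _ ≤ (C + max x₁ 1) * y ^ (1 / 2 + ε) := by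
          gcongr; exact le_add_of_nonneg_right (by positivity)
  · push Not at hyy
    calc |(mertensFunction y : ℝ)| ≤ y := abs_mertensFunction_le hy0.le
      _ ≤ max x₁ 1 := hyy.le.trans (le_max_left _ _)
      _ ≤ max x₁ 1 * y ^ (1 / 2 + ε) := le_mul_of_one_le_right (by positivity) hyp
      _ ≤ (C + max x₁ 1) * y ^ (1 / 2 + ε) := by gcongr; linarith

/-- `L(N) = ∑_{a ≤ N} [a = □] · M(⌊N/a⌋)` with the tree's `mertensFunction`
(`LiouvilleSum.sum_liouville_eq`). [cite: MossinghoffTrudgian2012, §2] -/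
theorem liouvilleSum_nat_eq (N : ℕ) :
    (liouvilleSum N : ℝ) =
      ∑ a ∈ Ioc 0 N, (if IsSquare a then (1 : ℝ) else 0) *
        (mertensFunction ((N / a : ℕ) : ℝ) : ℝ) := by
  unfold liouvilleSum mertensFunction
  simp_rw [Nat.floor_natCast]
  push_cast
  exact LiouvilleSum.sum_liouville_eq N

/-- The bound at the integers: if `|M(y)| ≤ C y^{1/2+ε}` for `y ≥ 1`, then
`|L(N)| ≤ C · (∑_{r ≥ 1} r^{−1−2ε}) · N^{1/2+ε}`. [cite: MossinghoffTrudgian2012, Thm. 2.2] -/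
theorem abs_liouvilleSum_nat_le {ε C : ℝ} (hε : 0 < ε) (hC : 0 ≤ C)
    (hM : ∀ y : ℝ, 1 ≤ y → |(mertensFunction y : ℝ)| ≤ C * y ^ (1 / 2 + ε)) (N : ℕ) :
    |(liouvilleSum N : ℝ)| ≤
      C * (∑' r : ℕ, 1 / (r : ℝ) ^ (1 + 2 * ε)) * (N : ℝ) ^ (1 / 2 + ε) := by
  have hsum : Summable (fun r : ℕ => 1 / (r : ℝ) ^ (1 + 2 * ε)) :=
    Real.summable_one_div_nat_rpow.2 (by linarith)
  have hN0 : (0 : ℝ) ≤ N := Nat.cast_nonneg N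
  set p : ℝ := 1 / 2 + ε with hp
  have hp0 : 0 ≤ p := by rw [hp]; linarith
  -- each square `a = r * r ≤ N` contributes `≤ C (N/a)^p = C N^p / r^{1+2ε}`
  have hterm : ∀ a ∈ Ioc 0 N,
      |(if IsSquare a then (1 : ℝ) else 0) * (mertensFunction ((N / a : ℕ) : ℝ) : ℝ)| ≤
        (if IsSquare a then (1 : ℝ) else 0) * (C * ((N : ℝ) / a) ^ p) := by
    intro a ha
    rw [mem_Ioc] at ha
    split_ifs with hsq
    · rw [one_mul, one_mul]
      have ha0 : (0 : ℝ) < a := by exact_mod_cast ha.1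
      have h1 : (1 : ℝ) ≤ ((N / a : ℕ) : ℝ) := by
        exact_mod_cast Nat.div_pos ha.2 ha.1
      calc |(mertensFunction ((N / a : ℕ) : ℝ) : ℝ)| ≤ C * (((N / a : ℕ) : ℝ)) ^ p := hM _ h1
        _ ≤ C * ((N : ℝ) / a) ^ p := by
            gcongr
            exact Nat.cast_div_le
    · simp
  calc |(liouvilleSum N : ℝ)|
      = |∑ a ∈ Ioc 0 N, (if IsSquare a then (1 : ℝ) else 0) *
          (mertensFunction ((N / a : ℕ) : ℝ) : ℝ)| := by rw [liouvilleSum_nat_eq]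
    _ ≤ ∑ a ∈ Ioc 0 N, |(if IsSquare a then (1 : ℝ) else 0) *
          (mertensFunction ((N / a : ℕ) : ℝ) : ℝ)| := abs_sum_le_sum_abs _ _
    _ ≤ ∑ a ∈ Ioc 0 N, (if IsSquare a then (1 : ℝ) else 0) * (C * ((N : ℝ) / a) ^ p) :=
        sum_le_sum hterm
    _ = ∑ a ∈ (Ioc 0 N).filter IsSquare, C * ((N : ℝ) / a) ^ p := by
        rw [sum_filter]; refine sum_congr rfl fun a _ => ?_; split_ifs <;> simp
    _ = ∑ r ∈ Ioc 0 (Nat.sqrt N), C * ((N : ℝ) / ((r * r : ℕ) : ℝ)) ^ p := by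
        rw [SiegelWalfiszLiouville.filter_isSquare_Ioc_eq_image, sum_image]
        intro x _ y _ hxy
        exact Nat.mul_self_inj.mp hxy
    _ = ∑ r ∈ Ioc 0 (Nat.sqrt N), C * (N : ℝ) ^ p * (1 / (r : ℝ) ^ (1 + 2 * ε)) := by
        refine sum_congr rfl fun r hr => ?_
        rw [mem_Ioc] at hr
        have hr0 : (0 : ℝ) < r := by exact_mod_cast hr.1
        rw [div_rpow hN0 (by positivity), Nat.cast_mul, ← sq, ← rpow_natCast,
          ← rpow_mul hr0.le]
        rw [show ((2 : ℕ) : ℝ) * p = 1 + 2 * ε by rw [hp]; push_cast; ring]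
        ring
    _ = C * (N : ℝ) ^ p * ∑ r ∈ Ioc 0 (Nat.sqrt N), 1 / (r : ℝ) ^ (1 + 2 * ε) := by
        rw [mul_sum]
    _ ≤ C * (N : ℝ) ^ p * ∑' r : ℕ, 1 / (r : ℝ) ^ (1 + 2 * ε) := by
        gcongr
        exact hsum.sum_le_tsum _ fun r _ => by positivity
    _ = C * (∑' r : ℕ, 1 / (r : ℝ) ^ (1 + 2 * ε)) * (N : ℝ) ^ p := by ring

end LiouvilleBigO

open LiouvilleBigO in
/-- **RH implies `|L(x)| ≤ C_ε x^{1/2+ε}` for all `x ≥ 1`**, every `ε > 0` (Mossinghoff–Trudgian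
2012, Thm. 2.2, case `α = 0`, in explicit-range form), PROVED from the tree's Littlewood criterion
for `M` and `λ = 𝟙_□ ⋆ μ`; the constant is `C · ζ(1 + 2ε)` with `C` the RH-constant for `M`.
[cite: MossinghoffTrudgian2012, Thm. 2.2; Titchmarsh1986, Thm. 14.25 (C)] -/
theorem exists_abs_liouvilleSum_le_of_riemannHypothesis (hRH : RiemannHypothesis) {ε : ℝ}
    (hε : 0 < ε) :
    ∃ C : ℝ, 0 < C ∧ ∀ x : ℝ, 1 ≤ x → |(liouvilleSum x : ℝ)| ≤ C * x ^ (1 / 2 + ε) := by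
  obtain ⟨C, hC0, hC⟩ :=
    exists_abs_mertensFunction_le hε ((riemannHypothesis_iff_mertensFunction_isBigO_holds.1 hRH) ε hε)
  set S : ℝ := ∑' r : ℕ, 1 / (r : ℝ) ^ (1 + 2 * ε) with hS
  have hS1 : 1 ≤ S := by
    have h1 : ∑ r ∈ ({1} : Finset ℕ), 1 / (r : ℝ) ^ (1 + 2 * ε) ≤ S :=
      (Real.summable_one_div_nat_rpow.2 (by linarith)).sum_le_tsum _ fun r _ => by positivity
    simpa using h1
  refine ⟨C * S, by nlinarith, fun x hx => ?_⟩
  have hx0 : 0 ≤ x := by linarith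
  rw [← liouvilleSum_natFloor x]
  calc |(liouvilleSum ((⌊x⌋₊ : ℕ) : ℝ) : ℝ)| ≤ C * S * ((⌊x⌋₊ : ℕ) : ℝ) ^ (1 / 2 + ε) :=
        abs_liouvilleSum_nat_le hε hC0.le hC ⌊x⌋₊
    _ ≤ C * S * x ^ (1 / 2 + ε) := by
        gcongr
        exact Nat.floor_le hx0

/-- **`RH ⟺ L(x) = O(x^{1/2+ε})` for every `ε > 0`** (Mossinghoff–Trudgian 2012, Thm. 2.2 with
`α = 0`: "It is well known that the Riemann hypothesis is equivalent to the statement that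
`L₀(x) = O(x^{1/2+ε})`"; the Liouville companion of Littlewood's Möbius criterion
`riemannHypothesis_iff_mertensFunction_isBigO`), PROVED.
[cite: MossinghoffTrudgian2012, §2 and Thm. 2.2 (α = 0)] -/
theorem riemannHypothesis_iff_liouvilleSum_isBigO :
    RiemannHypothesis ↔ ∀ ε : ℝ, 0 < ε →
      (fun x : ℝ => (liouvilleSum x : ℝ)) =O[atTop] fun x : ℝ => x ^ (1 / 2 + ε) := by
  refine ⟨fun h ε hε => ?_, riemannHypothesis_of_liouvilleSum_isBigO⟩
  obtain ⟨C, -, hC⟩ := exists_abs_liouvilleSum_le_of_riemannHypothesis h hε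
  refine IsBigO.of_bound C ?_
  filter_upwards [eventually_ge_atTop (1 : ℝ)] with x hx
  rw [Real.norm_eq_abs, Real.norm_of_nonneg (rpow_nonneg (by linarith) _)]
  exact hC x hx

end Literature.NumberTheory.LFunctions

end
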